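import Literature.IUT.HodgeTheaters.PuncturedEllipticProLModelXbar
import Literature.IUT.HodgeTheaters.PuncturedEllipticCoveringsModLCuspLaws
import Literature.IUT.HodgeTheaters.PuncturedEllipticCoveringsArrowClaimsOfModLCuspLaws
import HarnessLib

/-!
# An infinite pro-`l` model of [IUTchI] §1, part 7: (L2a), (L2c), (L3) and abc-iut-L5-t1's `ModLCuspLaws` at the datum

Mochizuki, *Inter-universal Teichmüller theory I*, kurims manuscript (May 2020), §1 pp. 37–38: "`Δ_X̲ ↠ Δ_X̲^{ab} ⊗
(ℤ/lℤ) ↠ Δ_ε` … `0 → I_ε′ × I_ε″ → Δ_ε → Δ_E ⊗ (ℤ/lℤ) → 0` … `ι` acts on `Δ_E ⊗ (ℤ/lℤ)` via multiplication by `−1`"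
(p. 37 l. 30 – p. 38 l. 24), typed by abc-iut-L5-t1 as `PuncturedEllipticData.ModLCuspLaws` (p446054) ([IUTchI] §1 p.37)
[claim: Mochizuki2012, status: disputed] (D-0012 claim key; series status DISPUTED — WITNESS-class PROOF-ONLY module;
nothing of the series is asserted, no side is taken on [IUTchIII] Cor. 3.12).

At the pro-`l` datum `ProLModel.datum l h5` (abc-iut-L5-d4, parts 1–6; `Δ_X̲ = N × lℤ_l` abelian, `I_i = ℤ_l · c_i`,
`c_i = B_{i+1} − B_i`, `ε⁰, ε′, ε″ = 0, 1, −1`):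
* `coord1_of_mem_inertia_two_sup_deltaEpsKer` — the coordinate-`B_1` functional `(v) ↦ v_1 mod l` kills `Ker(Δ_X̲ ↠ Δ_ε)`
  and `I_ε″` (every generator `c_x`, `x ∉ {0, 1}`, vanishes at `B_1`; `l`-th powers vanish mod `l`);
* **(L2c) `inertia_images_inf_le_datum`** — `I_ε′ ∩ (I_ε″ · Ker) ⊆ Ker` (`(t·c_1)_1 = −t`);
* **(L2a) `inertia_ε1_image_order_datum`** — `[I_ε′ · Ker : Ker] = l` (the functional is onto `ℤ/l` on `I_ε′`);
* **(L3) `iota_neg_datum`** — `ι̲ v ι̲⁻¹ v = (w + σ_0 w)` has coordinate sum `0`, hence lies in the span of the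
  inertia lines `ℤ_l·c_x`, `x ≠ 0` (part 6's `inN_sub_sum_mem_of_cvec_mem`), all inside `I_ε′ · I_ε″ · Ker`;
* **`modLCuspLaws_datum : (datum l h5).ModLCuspLaws`** — abc-iut-L5-t1's record INHABITED at the infinite datum (with
  (L0), (L1), (L4) of part 6), jointly with `CuspGalois` (part 3), `[Δ_X : H] = l²` (part 4), `GeomTFG`, `huniq′`
  (part 5); the opened fields (L2a) (L2c) (L3) (L4) are the law binders `hL2a hL2c hL3 hL4` of the current Cor. 1.2
  closer `…_of_originLaws_modLFields` (abc-iut-f-090).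
HONEST LABEL: semi-synthetic model (`G_k = 1`) — consistency evidence for OUR typed binders / the `Δ_X̲`-abelian shadow of a
GeomOrigin datum; no `sorry`; symbolic prime `l`.
-/

noncomputable section

namespace Literature.IUT.HodgeTheaters

namespace PuncturedEllipticData

namespace ProLModel

open DihedralGroup _root_.Topology Literature.AnabelianGeometry.AbsoluteAnabelian
open scoped Pointwise commutatorElement

variable (l : ℕ) [Fact l.Prime]

/-! ### Helpers -/

/-- `x ≡ 0 (mod l)` in `ℤ_l` means `x = l·t`. [folklore] -/
private theorem exists_eq_mul_of_toZMod_eq_zero' {x : ℤ_[l]} (hx : PadicInt.toZMod x = 0) :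
    ∃ t : ℤ_[l], x = l * t := by
  have hx' : x ∈ RingHom.ker (PadicInt.toZMod (p := l)) := hx
  rw [PadicInt.ker_toZMod, PadicInt.maximalIdeal_eq_span_p, Ideal.mem_span_singleton'] at hx'
  obtain ⟨t, ht⟩ := hx'
  exact ⟨t, by rw [← ht, mul_comm]⟩

/-- In a group, `H ⊔ K = H · K` as soon as `H` and `K` commute elementwise. [folklore] -/
private theorem exists_mul_eq_of_mem_sup {G : Type*} [Group G] {H K : Subgroup G}
    (hc : ∀ h ∈ H, ∀ k ∈ K, h * k = k * h) {x : G} (hx : x ∈ H ⊔ K) : ∃ h ∈ H, ∃ k ∈ K, h * k = x := by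
  rw [Subgroup.sup_eq_closure] at hx
  induction hx using Subgroup.closure_induction with
  | mem y hy =>
    rcases hy with hy | hy
    · exact ⟨y, hy, 1, K.one_mem, mul_one y⟩
    · exact ⟨1, H.one_mem, y, hy, one_mul y⟩
  | one => exact ⟨1, H.one_mem, 1, K.one_mem, mul_one 1⟩
  | mul y z _ _ hy hz =>
    obtain ⟨h₁, hh₁, k₁, hk₁, rfl⟩ := hy
    obtain ⟨h₂, hh₂, k₂, hk₂, rfl⟩ := hz
    refine ⟨h₁ * h₂, H.mul_mem hh₁ hh₂, k₁ * k₂, K.mul_mem hk₁ hk₂, ?_⟩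
    calc h₁ * h₂ * (k₁ * k₂) = h₁ * (h₂ * k₁) * k₂ := by group
      _ = h₁ * (k₁ * h₂) * k₂ := by rw [hc h₂ hh₂ k₁ hk₁]
      _ = h₁ * k₁ * (h₂ * k₂) := by group
  | inv y _ hy =>
    obtain ⟨h, hh, k, hk, rfl⟩ := hy
    refine ⟨h⁻¹, H.inv_mem hh, k⁻¹, K.inv_mem hk, ?_⟩
    rw [mul_inv_rev, hc h⁻¹ (H.inv_mem hh) k⁻¹ (K.inv_mem hk)]

/-- The `B_1`-coordinate of `t · c_x`. [claim: Mochizuki2012, status: disputed] -/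
theorem smul_cvec_apply_one (t : ℤ_[l]) (x : ZMod l) :
    (t • cvec l x) 1 = t * ((if (1 : ZMod l) = x + 1 then 1 else 0) - (if (1 : ZMod l) = x then 1 else 0)) := by
  rw [Pi.smul_apply, cvec_apply, smul_eq_mul]

/-- `t·c_1` with `t ≡ 0 (mod l)` is an `l`-th power in `Δ_X̲`, hence lies in `Ker(Δ_X̲ ↠ Δ_X̲^{ab} ⊗ ℤ/l)`.
[claim: Mochizuki2012, status: disputed] -/
theorem inN_smul_cvec_mem_modLKer (h5 : 5 ≤ l) {t : ℤ_[l]} (ht : PadicInt.toZMod t = 0) (x : ZMod l) :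
    inN l (t • cvec l x) ∈ (datum l h5).modLKer := by
  obtain ⟨t', rfl⟩ := exists_eq_mul_of_toZMod_eq_zero' l ht
  refine Subgroup.le_topologicalClosure _ (Subgroup.mem_sup_right (Subgroup.subset_closure ?_))
  refine ⟨inN l (t' • cvec l x), ?_, ?_⟩
  · rw [SetLike.mem_coe, deltaXbar_eq]; exact inN_mem_PiXbar l _
  · change inN l (t' • cvec l x) ^ l = _
    rw [← inN_natCast_smul, smul_smul]

/-! ### The `B_1`-coordinate functional kills `I_ε″ · Ker(Δ_X̲ ↠ Δ_ε)` -/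

/-- **Upper bound**: every element of `I_ε″ ⊔ Ker(Δ_X̲ ↠ Δ_ε)` lies in `Π_X̲` and has `B_1`-coordinate `≡ 0 (mod l)`.
[claim: Mochizuki2012, status: disputed] -/
theorem coord1_of_mem_inertia_two_sup_deltaEpsKer (h5 : 5 ≤ l) {g : P l}
    (hg : g ∈ (datum l h5).inertia (datum l h5).ε2 ⊔ (datum l h5).deltaEpsKer) :
    g ∈ PiXm l ⊓ PiCbarm l ∧ PadicInt.toZMod (Multiplicative.toAdd g.left 1) = 0 := by
  classical
  haveI : Fact (1 < l) := ⟨(Fact.out : l.Prime).one_lt⟩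
  obtain ⟨h10, hm10, h1m1, -⟩ := ArrowModel.cusp_facts_of_five_le l h5
  -- the subgroup `K₁ = {g ∈ Π_X̲ : (g.left)_1 ≡ 0}`
  let K₁ : Subgroup (P l) :=
    { carrier := {g | g ∈ PiXm l ⊓ PiCbarm l ∧ PadicInt.toZMod (Multiplicative.toAdd g.left 1) = 0}
      one_mem' := ⟨Subgroup.one_mem _, by
        rw [SemidirectProduct.one_left, toAdd_one, Pi.zero_apply, map_zero]⟩
      mul_mem' := fun {a b} ha hb => ⟨Subgroup.mul_mem _ ha.1 hb.1, by
        rw [left_mul_of_mem_PiXbar l ha.1, toAdd_mul, Pi.add_apply, map_add, ha.2, hb.2, add_zero]⟩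
      inv_mem' := fun {a} ha => ⟨Subgroup.inv_mem _ ha.1, by
        have h := left_mul_of_mem_PiXbar l (Subgroup.inv_mem _ ha.1) a
        rw [inv_mul_cancel, SemidirectProduct.one_left] at h
        have h' : Multiplicative.toAdd a⁻¹.left 1 = -Multiplicative.toAdd a.left 1 := by
          rw [eq_neg_iff_add_eq_zero, ← Pi.add_apply, ← toAdd_mul, ← h, toAdd_one, Pi.zero_apply]
        rw [h', map_neg, ha.2, neg_zero]⟩ }
  have hKmem : ∀ x, x ∈ K₁ ↔ x ∈ PiXm l ⊓ PiCbarm l ∧ PadicInt.toZMod (Multiplicative.toAdd x.left 1) = 0 :=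
    fun x => Iff.rfl
  -- `K₁` is closed
  have hKclosed : IsClosed (K₁ : Set (P l)) := by
    have hK : (K₁ : Set (P l)) = ((PiXm l ⊓ PiCbarm l : Subgroup (P l)) : Set (P l)) ∩
        (fun g : P l => PadicInt.toZMod (Multiplicative.toAdd g.left 1)) ⁻¹' {0} := rfl
    rw [hK]
    refine ((PiXm l ⊓ PiCbarm l).isClosed_of_isOpen ((isOpen_PiXm l).inter (isOpen_PiCbarm l))).inter
      ((isClosed_discrete _).preimage ?_)
    have hc : Continuous fun g : P l => (PadicInt.toZMod (∑ m, Multiplicative.toAdd g.left m),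
        PadicInt.toZMod (Multiplicative.toAdd g.right.left)) := coords_continuous l
    -- continuity of `toZMod` extracted from `coords_continuous` would be roundabout; argue directly:
    have hz : Continuous (PadicInt.toZMod : ℤ_[l] → ZMod l) := by
      refine continuous_of_continuousAt_zero (PadicInt.toZMod (p := l)) ?_
      rw [ContinuousAt, map_zero, nhds_discrete (ZMod l), Filter.tendsto_pure]
      filter_upwards [Metric.ball_mem_nhds (0 : ℤ_[l]) one_pos] with x hx
      rwa [Metric.mem_ball, dist_zero_right, ← PadicInt.mem_nonunits, ← IsLocalRing.mem_maximalIdeal,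
        ← PadicInt.ker_toZMod, RingHom.mem_ker] at hx
    exact hz.comp ((continuous_apply 1).comp (continuous_toAdd.comp (continuous_left_right_P l).1))
  -- inertia lines `ℤ_l·c_x` with `x ≠ 0, 1` lie in `K₁`
  have hI : ∀ x : ZMod l, x ≠ 0 → x ≠ 1 → Dm l x ≤ K₁ := by
    rintro x hx0 hx1 _ ⟨s, rfl⟩
    refine ⟨inN_mem_PiXbar l _, ?_⟩
    rw [inertiaHom_apply, inN_left, toAdd_ofAdd, smul_cvec_apply_one,
      if_neg (fun h => hx0 (by linear_combination -h)), if_neg (Ne.symm hx1), sub_zero, mul_zero, map_zero]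
  -- `Ker(Δ_X̲ ↠ Δ_X̲^{ab} ⊗ ℤ/l) ≤ K₁`
  have hM : (datum l h5).modLKer ≤ K₁ := by
    refine Subgroup.topologicalClosure_minimal _ (sup_le ?_ ?_) hKclosed
    · rw [deltaXbar_eq, Subgroup.commutator_le]
      intro a ha b hb
      rw [commutatorElement_def, commute_of_mem_PiXbar l ha hb, mul_inv_cancel_right, mul_inv_cancel]
      exact K₁.one_mem
    · rw [Subgroup.closure_le, deltaXbar_eq]
      rintro _ ⟨w, hw, rfl⟩
      obtain ⟨hw1, hw2⟩ := (mem_PiXbar_iff l w).1 hw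
      rw [decomp_of_mem_PiXm l hw.1]
      change (inN l (Multiplicative.toAdd w.left) * elA l (Multiplicative.toAdd w.right.left)) ^ l ∈ K₁
      rw [inN_mul_elA_pow l hw2]
      refine ⟨Subgroup.mul_mem _ (inN_mem_PiXbar l _) (elA_mem_PiXbar l (by
        rw [map_mul, map_natCast, ZMod.natCast_self, zero_mul])), ?_⟩
      rw [left_mul_of_mem_PiXbar l (inN_mem_PiXbar l _), inN_left]
      change PadicInt.toZMod (Multiplicative.toAdd (Multiplicative.ofAdd ((l : ℤ_[l]) • Multiplicative.toAdd w.left) *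
        (1 : N l)) 1) = 0
      rw [mul_one, toAdd_ofAdd, Pi.smul_apply, smul_eq_mul, map_mul, map_natCast, ZMod.natCast_self, zero_mul]
  -- assemble
  have hle : (datum l h5).inertia (datum l h5).ε2 ⊔ (datum l h5).deltaEpsKer ≤ K₁ := by
    refine sup_le ?_ (sup_le hM (iSup_le fun x => ?_))
    · rw [inertia_eq]; exact hI (-1) hm10 (Ne.symm h1m1)
    · rw [inertia_eq]; exact hI x.1 x.2.1 x.2.2.1
  exact (hKmem g).1 (hle hg)

/-! ### (L2c), (L2a) -/

/-- **(L2c) at the pro-`l` datum**: "`0 → I_ε′ × I_ε″ → Δ_ε`" — `I_ε′ ∩ (I_ε″ · Ker(Δ_X̲ ↠ Δ_ε)) ⊆ Ker(Δ_X̲ ↠ Δ_ε)`.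
([IUTchI] §1 p.37) [claim: Mochizuki2012, status: disputed] -/
theorem inertia_images_inf_le_datum (h5 : 5 ≤ l) :
    (datum l h5).inertia (datum l h5).ε1 ⊓ ((datum l h5).inertia (datum l h5).ε2 ⊔ (datum l h5).deltaEpsKer) ≤
      (datum l h5).deltaEpsKer := by
  haveI : Fact (1 < l) := ⟨(Fact.out : l.Prime).one_lt⟩
  rintro g ⟨hg1, hg2⟩
  rw [inertia_eq] at hg1
  obtain ⟨s, rfl⟩ := hg1
  have h := (coord1_of_mem_inertia_two_sup_deltaEpsKer l h5 hg2).2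
  rw [inertiaHom_apply, inN_left, toAdd_ofAdd, smul_cvec_apply_one,
    if_neg (fun h => (ArrowModel.cusp_facts_of_five_le l h5).1 (by linear_combination -h)), if_pos rfl, zero_sub,
    mul_neg, mul_one, map_neg, neg_eq_zero] at h
  rw [inertiaHom_apply]
  exact Subgroup.mem_sup_left (inN_smul_cvec_mem_modLKer l h5 h 1)

/-- **(L2a) at the pro-`l` datum**: "`I_ε′ ≅ ℤ/lℤ`" in `Δ_ε` — `[I_ε′ · Ker(Δ_X̲ ↠ Δ_ε) : Ker(Δ_X̲ ↠ Δ_ε)] = l` (the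
`B_1`-coordinate functional is onto `ℤ/l` on `I_ε′` with kernel `Ker`). ([IUTchI] §1 p.37) [claim: Mochizuki2012, status: disputed] -/
theorem inertia_ε1_image_order_datum (h5 : 5 ≤ l) :
    (datum l h5).deltaEpsKer.relIndex ((datum l h5).inertia (datum l h5).ε1 ⊔ (datum l h5).deltaEpsKer) =
      (datum l h5).l := by
  classical
  haveI : Fact (1 < l) := ⟨(Fact.out : l.Prime).one_lt⟩
  set A := (datum l h5).inertia (datum l h5).ε1 ⊔ (datum l h5).deltaEpsKer with hA
  set K := (datum l h5).deltaEpsKer with hK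
  have hKW : ∀ g ∈ K, g ∈ PiXm l ⊓ PiCbarm l := fun g hg =>
    (coord1_of_mem_inertia_two_sup_deltaEpsKer l h5 (Subgroup.mem_sup_right hg)).1
  have hAW : ∀ g ∈ A, g ∈ PiXm l ⊓ PiCbarm l := fun g hg => by
    refine (sup_le ?_ (fun x hx => hKW x hx) : A ≤ PiXm l ⊓ PiCbarm l) hg
    rw [inertia_eq]; exact Dm_le_PiXbar l 1
  -- the `B_1`-coordinate homomorphism on `A`
  let f : A →* Multiplicative (ZMod l) := MonoidHom.mk'
    (fun x => Multiplicative.ofAdd (PadicInt.toZMod (Multiplicative.toAdd x.1.left 1)))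
    (fun x y => by rw [← ofAdd_add, Subgroup.coe_mul, left_mul_of_mem_PiXbar l (hAW _ x.2), toAdd_mul, Pi.add_apply,
      map_add])
  have hf : ∀ x : A, f x = 1 ↔ PadicInt.toZMod (Multiplicative.toAdd x.1.left 1) = 0 := fun x => Iff.rfl
  have hker : f.ker = K.subgroupOf A := by
    ext x
    rw [MonoidHom.mem_ker, Subgroup.mem_subgroupOf, hf]
    constructor
    · intro hx
      have hcomm : ∀ a ∈ (datum l h5).inertia (datum l h5).ε1, ∀ b ∈ K, a * b = b * a := fun a ha b hb =>
        commute_of_mem_PiXbar l (hAW a (Subgroup.mem_sup_left ha)) (hKW b hb)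
      obtain ⟨a, ha, b, hb, hab⟩ := exists_mul_eq_of_mem_sup hcomm x.2
      rw [inertia_eq] at ha
      obtain ⟨s, rfl⟩ := ha
      have hbc := (coord1_of_mem_inertia_two_sup_deltaEpsKer l h5 (Subgroup.mem_sup_right hb)).2
      rw [← hab, inertiaHom_apply, left_mul_of_mem_PiXbar l (inN_mem_PiXbar l _), toAdd_mul, Pi.add_apply, map_add,
        hbc, add_zero, inN_left, toAdd_ofAdd, smul_cvec_apply_one,
        if_neg (fun h => (ArrowModel.cusp_facts_of_five_le l h5).1 (by linear_combination -h)), if_pos rfl, zero_sub,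
        mul_neg, mul_one, map_neg, neg_eq_zero] at hx
      rw [← hab, inertiaHom_apply]
      exact K.mul_mem (Subgroup.mem_sup_left (inN_smul_cvec_mem_modLKer l h5 hx 1)) hb
    · intro hx
      exact (coord1_of_mem_inertia_two_sup_deltaEpsKer l h5 (Subgroup.mem_sup_right hx)).2
  have hsurj : Function.Surjective f := by
    intro k
    have hmem : inN l ((-((Multiplicative.toAdd k).val : ℤ_[l])) • cvec l 1) ∈ A := by
      refine Subgroup.mem_sup_left ?_
      rw [inertia_eq]
      exact ⟨Multiplicative.ofAdd _, by rw [inertiaHom_apply, toAdd_ofAdd]⟩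
    refine ⟨⟨_, hmem⟩, ?_⟩
    change Multiplicative.ofAdd (PadicInt.toZMod (Multiplicative.toAdd
      (inN l ((-((Multiplicative.toAdd k).val : ℤ_[l])) • cvec l 1)).left 1)) = k
    rw [inN_left, toAdd_ofAdd, smul_cvec_apply_one,
      if_neg (fun h => (ArrowModel.cusp_facts_of_five_le l h5).1 (by linear_combination -h)), if_pos rfl, zero_sub,
      mul_neg, mul_one, neg_neg, map_natCast, ZMod.natCast_zmod_val, ofAdd_toAdd]
  change K.relIndex A = l
  rw [Subgroup.relIndex, ← hker, Subgroup.index_ker, MonoidHom.range_eq_top.mpr hsurj, Subgroup.card_top,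
    Nat.card_eq_fintype_card, Fintype.card_multiplicative, ZMod.card]

/-! ### (L3) -/

/-- `σ_0 w + w` has coordinate sum `0`. [claim: Mochizuki2012, status: disputed] -/
theorem sum_refl_zero_add (w : V l) : ∑ m, (refl l 0 w + w) m = 0 := by
  simp only [Pi.add_apply, refl_apply, sub_zero, Finset.sum_add_distrib, Finset.sum_neg_distrib]
  rw [neg_add_eq_zero]
  exact Fintype.sum_equiv (Equiv.subLeft (1 : ZMod l)) _ _ fun m => rfl

/-- **(L3) at the pro-`l` datum**: "`ι` acts on `Δ_E ⊗ (ℤ/lℤ)` via multiplication by `−1`" — for `ι̲ ∈ Δ_C̲ ∖ Δ_X̲` and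
`v ∈ Δ_X̲`, `ι̲ v ι̲⁻¹ v ∈ I_ε′ · I_ε″ · Ker(Δ_X̲ ↠ Δ_ε)` (it is `(σ_0 w + w)`, of coordinate sum `0`).
([IUTchI] §1 p.38) [claim: Mochizuki2012, status: disputed] -/
theorem iota_neg_datum (h5 : 5 ≤ l) : ∀ c ∈ (datum l h5).DeltaCbar, c ∉ (datum l h5).DeltaXbar →
    ∀ v ∈ (datum l h5).DeltaXbar, c * v * c⁻¹ * v ∈
      (datum l h5).inertia (datum l h5).ε1 ⊔ (datum l h5).inertia (datum l h5).ε2 ⊔ (datum l h5).deltaEpsKer := by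
  intro c hc hcX v hv
  rw [deltaCbar_eq] at hc
  rw [deltaXbar_eq] at hcX hv
  have hcX' : c ∉ PiXm l := fun h => hcX ⟨h, hc⟩
  obtain ⟨-, hs⟩ := (mem_PiXbar_iff l v).1 hv
  set w : V l := Multiplicative.toAdd v.left
  set s : ℤ_[l] := Multiplicative.toAdd v.right.left
  have hv' := decomp_of_mem_PiXm l hv.1
  -- `c (w) c⁻¹ = (σ_0 w)` and `c a^s c⁻¹ = a^{-s}`
  have h1 : c * inN l w * c⁻¹ = inN l (refl l 0 w) := by
    rw [conj_inN, toDih_right_of_mem_PiCbarm_not_PiXm l hc hcX', dact_sr]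
  have h2 : c * elA l s * c⁻¹ = elA l (-s) := conj_elA_of_not_mem_PiXm l hcX' hs
  have hcomm : elA l (-s) * inN l w = inN l w * elA l (-s) :=
    commute_of_mem_PiXbar l (elA_mem_PiXbar l (by rw [map_neg, hs, neg_zero])) (inN_mem_PiXbar l w)
  have hprod : c * v * c⁻¹ * v = inN l (refl l 0 w + w) := by
    rw [hv']
    calc c * (inN l w * elA l s) * c⁻¹ * (inN l w * elA l s)
        = (c * inN l w * c⁻¹) * (c * elA l s * c⁻¹) * (inN l w * elA l s) := by group
      _ = inN l (refl l 0 w) * (elA l (-s) * inN l w) * elA l s := by rw [h1, h2]; group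
      _ = inN l (refl l 0 w + w) := by
          rw [hcomm, inN_add, ← mul_assoc, mul_assoc (inN l (refl l 0 w) * inN l w), ← elA_add, neg_add_cancel]
          have : elA l 0 = 1 := by unfold elA; rw [ofAdd_zero, map_one, map_one]
          rw [this, mul_one]
  rw [hprod]
  have hsum := sum_refl_zero_add l w
  have key := inN_sub_sum_mem_of_cvec_mem l
    ((datum l h5).inertia (datum l h5).ε1 ⊔ (datum l h5).inertia (datum l h5).ε2 ⊔ (datum l h5).deltaEpsKer) ?_
    (refl l 0 w + w)
  · rwa [hsum, zero_smul, sub_zero] at key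
  · intro x hx0 t
    have hmemx : inN l (t • cvec l x) ∈ Dm l x := ⟨Multiplicative.ofAdd t, by rw [inertiaHom_apply, toAdd_ofAdd]⟩
    by_cases hx1 : x = 1
    · subst hx1
      refine Subgroup.mem_sup_left (Subgroup.mem_sup_left ?_)
      rw [inertia_eq]; exact hmemx
    by_cases hx2 : x = -1
    · subst hx2
      refine Subgroup.mem_sup_left (Subgroup.mem_sup_right ?_)
      rw [inertia_eq]; exact hmemx
    · refine Subgroup.mem_sup_right (Subgroup.mem_sup_right ?_)
      refine Subgroup.mem_iSup_of_mem ⟨x, hx0, hx1, hx2⟩ ?_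
      change inN l (t • cvec l x) ∈ (datum l h5).inertia x
      rw [inertia_eq]; exact hmemx

/-! ### abc-iut-L5-t1's `ModLCuspLaws` at the datum -/

/-- **abc-iut-L5-t1's record `ModLCuspLaws` INHABITED at the pro-`l` datum** — the six printed `Δ_ε`-level sentences
(L0) (L1) (L2a) (L2c) (L3) (L4) hold at `ProLModel.datum l h5`, jointly with `CuspGalois` (part 3).
([IUTchI] §1 pp.37–38) [claim: Mochizuki2012, status: disputed] -/
theorem modLCuspLaws_datum (h5 : 5 ≤ l) : (datum l h5).ModLCuspLaws where
  modLKer_relIndex_ne_zero := modLKer_relIndex_ne_zero_datum l h5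
  inertia_procyclic := inertia_procyclic_datum l h5
  inertia_ε1_image_order := inertia_ε1_image_order_datum l h5
  inertia_images_inf_le := inertia_images_inf_le_datum l h5
  iota_neg := iota_neg_datum l h5
  inertia_central := inertia_central_datum l h5

/-- **The printed claims of p. 38 (`ArrowCoveringClaims`: `Δ_ε⁺ ≅ ℤ/l`, `I_ε′ ⥲ Δ_ε⁺`, the section, the cartesian
square, indices `l`, `2l`, cyclic Galois groups) HOLD at the pro-`l` datum**, by abc-iut-L5-t1's
`CuspGalois.arrowCoveringClaims_of_modLCuspLaws` BY NAME from `cuspGalois` + `modLCuspLaws_datum` + the involution `ι`.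
([IUTchI] §1 p.38) [claim: Mochizuki2012, status: disputed] -/
theorem arrowCoveringClaims_datum (h5 : 5 ≤ l) : (datum l h5).ArrowCoveringClaims := by
  refine (cuspGalois l h5).arrowCoveringClaims_of_modLCuspLaws (modLCuspLaws_datum l h5) ?_
  refine ⟨SemidirectProduct.inr (SemidirectProduct.inr (Multiplicative.ofAdd 1)), ?_, ?_⟩
  · rw [deltaCbar_eq, mem_PiCbarm_iff]
    right
    rw [SemidirectProduct.right_inr, toDih_apply, SemidirectProduct.left_inr, SemidirectProduct.right_inr, toAdd_one,
      map_zero, r_zero, one_mul]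
    have h1 : expo (Multiplicative.ofAdd (1 : ZMod 2)) = 1 := rfl
    rw [h1, pow_one]
  · rw [deltaXbar_eq, mem_PiXbar_iff, SemidirectProduct.right_inr, SemidirectProduct.right_inr]
    rintro ⟨h, -⟩
    exact absurd (congrArg Multiplicative.toAdd h) (by rw [toAdd_ofAdd, toAdd_one]; exact one_ne_zero)

end ProLModel

end PuncturedEllipticData

end Literature.IUT.HodgeTheaters
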